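import Mathlib
import Summits.ValiantsHypothesis.ValiantsHypothesis.Theorems.LacunarySymmetroidMatrixDescartesCensusLogPrimesTable

/-!
# `MatrixDescartes` census — W4 boundary layer: closed NUMERAL FACTS for the kernel kill of `ZP(3..19)` on `(0,3,4,10,22,39)`

HONEST FRAMING.  Object-search cell `pub-symmetroid`, item `DoorA26 = PosRootLawAt 2 6 19` (stmt-ValiantsHypothesis-19979, OPEN, typed,
never asserted).  Companion («Rows») file of `…CensusZp319On…` (theorem `countP_posRoots_zp_3_19_le_on_0_3_4_10_22_39`): the numeric side
conditions of its typed face-row-LP certificate — for every weighted circuit row `(r,s,u)` the three integer twist multipliers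
`|∏_{v ∉ {r,s,u}} (e_t − e_v)|` over the exponent table (a list literal), each in its OWN declaration (own heartbeat budget), by
`norm_num` (the leaves themselves close over the certified log table, so no row constant `L, R` or leaf numeral is needed).  Pure arithmetic; generated by the seat tool `tools/kernel/genzp3.py`.  Nothing here is a statement about pencils.

[folklore] Integer arithmetic; no source.
-/

-- `Summit.ValiantsHypothesis.ValiantsHypothesis.…` repeats a component by the D-0017 layout
-- (single-conjunct summit), which the `dupNamespace` linter flags; the name is mandated.
set_option linter.dupNamespace false

namespace Summit.ValiantsHypothesis.ValiantsHypothesis.Theorems.LacunarySymmetroidMatrixDescartes.Census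

open Finset

/-- `log 2729735612589186938880` (a twist multiplier of this support) over the prime table (generated). [folklore] -/
theorem zp_3_19_on_0_3_4_10_22_39_lg_2729735612589186938880 : Real.log (2729735612589186938880 : ℝ) = 11 * Real.log (2 : ℝ) + 11 * Real.log (3 : ℝ) + 1 * Real.log (5 : ℝ) + 2 * Real.log (11 : ℝ) + 1 * Real.log (13 : ℝ) + 1 * Real.log (17 : ℝ) + 1 * Real.log (19 : ℝ) + 1 * Real.log (29 : ℝ) + 1 * Real.log (41 : ℝ) + 1 * Real.log (47 : ℝ) + 1 * Real.log (53 : ℝ) := by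
  have h := LogPrimes.log_nat_eq_of_factored 2729735612589186938880 11 11 1 0 2 1 1 1 0 1 0 0 1 0 1 1 0 0 0 0 0 0 (by norm_num); push_cast at h; linarith only [h]

end Summit.ValiantsHypothesis.ValiantsHypothesis.Theorems.LacunarySymmetroidMatrixDescartes.Census
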